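import Summits.FinalStateConjecture.FinalStateConjecture.Theses.SignedCensus
import Summits.FinalStateConjecture.FinalStateConjecture.Theorems.ZeroEnergyKerrOrBombSymplecticDualOfTheBombSig4
import Literature.Geometry.Lorentzian.TameGenericityDiagonal
import Literature.Geometry.Lorentzian.CausalityOpennessProofs
import Literature.Geometry.Lorentzian.LeviCivitaProofs
import HarnessLib

/-!
# Birth skeleton (BC3) — crux `SignedCensus.NoHairToFinalState` (stmt-FinalStateConjecture-10828), line `birth`

Skeleton registrar planner-skel-stmt-FinalStateConjecture-10828-0, 2026-08-17 (route re-audit bin REPAIRABLE); published as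
`Cruxes/NoHairToFinalState/Lines/birth.lean`. The crux is FIXED and concluded BY NAME (`noHairToFinalState_of_stubs`,
`NoHairToFinalState_of`):

  `Summit.FinalStateConjecture.FinalStateConjecture.Theses.SignedCensus.NoHairToFinalState`
  `:= (rotation-graded smooth no-hair, ∀ levels s — the route's target GradedNoHair, unfolded) → FinalStateConjecture`

— the DYNAMICAL LEG of route SignedCensus (rank 5; "shared with every stationary-limit route"): given that every regular
smooth stationary AF vacuum black hole (globally hyperbolic carrier, Cauchy slice, connected non-degenerate `𝓔⁺`,
normalised `T`, rotation level `≤ s`, vacuum) has d.o.c. isometric to a sub-extremal Kerr exterior, the re-typed summit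
(T2: TAME genericity on one fixed end, honest radii, `RaysStayInClosure`, `IsFutureOriented`) holds.

## The cut — the route's own two-layer plan ("AsymptoticStationarity → KerrChartsExhaust → NoHairToFinalState"), typed over
## the tree and over the LANDED vocabulary of the sibling frames of identical shape

Two served cruxes have exactly this shape `X → FinalStateConjecture` with a rigidity statement `X`:
`ZeroEnergyKerrOrBomb.StationaryLimitReduction := KerrOrBomb → FSC` (stmt-10021) and `FinalStateFromKerrOrBomb :=
KerrOrBombModT → FSC` (stmt-17839), whose registered line (Cruxes/FinalStateFromKerrOrBomb/Lines/SketchIdeator1.lean,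
7 stubs) and ~30 landed `Theorems/ZeroEnergyKerrOrBomb…` modules built the currency for "settles down to finitely many
STATIONARY holes" (`StationaryFinalStateDecomposition`, prelude; `SettlesDocWithT2 Q`, Sig7), the chart-level Kerr
identification `IsKerrChartedWith`, the naive Kerr–Schild recut and the LANDED T2 chart transfer `chartTransferT2_unfolded`
(p136225). Their rigidity hypothesis is CONDITIONAL on mode stability, so most of their stubs (probe universality, dual-mode
ejection, Moncrief duality) exist to make limit holes of GENERIC data mode-stable. HERE the hypothesis is UNCONDITIONAL graded
no-hair for every level: the mode machinery is not needed, and the honest content of the crux is exactly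
  tame weak cosmic censorship  +  asymptotic stationarity (settling to REGULAR stationary vacuum holes = census holes)
  +  Kerr identification of the limits (where no-hair is consumed: the DOCK)  +  recut / T2 chart transfer.
So the four registered stubs are:

* S1a `stub_tameCensorship` (open problem; SHARED) — VERBATIM the route item `PhaseMixingCapture.WeakCosmicCensorshipTame`
  (stmt-17269): tame-generically, an MGHD exists and every MGHD has complete `𝓘⁺`.
* S1b `stub_settlingAlongCensoredCurves` (open problem; THE LOAD-BEARING DYNAMICS) — along every censored tame curve of
  admissible data one can pass, through the same base datum, a tame injective immersed curve whose members off `0` are GOOD: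
  MGHD exists and every MGHD settles, in the sibling T2 d.o.c. currency (`SettlesDocWithT2`-body: honest exterior,
  `HasExhaustiveDocCharts'`, `IsHorizonNormalised`, rays in the closure of the self-determined d.o.c., orientation-compatible
  charts, horizon-covering Cartesian / `C²`-Schwarzschildean adapted charts, telescope holes, `I⁺`-regular) to holes that
  satisfy the CENSUS CLAUSES (Cauchy slice, normalised `T`, bounded rotation level) — i.e. to holes in the antecedent of the
  crux hypothesis. The `hrel` shape of `InitialDataSet.isTameChristodoulouGeneric_of_relative'` (TameGenericityDiagonal):
  curve genericity is not closed under `∧`, so settling is produced ALONG censorship curves, never pointwise (the pointwise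
  form "censored ⇒ settles" is believed false — sibling Disproof §5: exactly-extremal final states, threshold data).
* S2 `stub_kerrIdentification` (classical, L/XL) — a charted, `I⁺`-regular telescope hole whose d.o.c. is a Kerr exterior IN
  THE ROUTE'S DIFFEOMORPH FORM (exactly what graded no-hair delivers) carries a future-preserving `T`-equivariant Kerr
  identification `IsKerrChartedWith` of its adapted chart (= sibling `Sig4.stub_kerrIsometryRigidity` after a format bridge,
  plus the LANDED F5 `kerrIdentificationFuture` p135232).
* S3 `stub_recutTransferT2` (L/XL, half landed) — oriented Kerr–Schild recut covering (sibling `Sig4.stub_recutCovering` /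
  `stub_recutJunctionCoreOriented`, open) followed by the LANDED `chartTransferT2_unfolded`: the summit's per-development
  conjunct with honest radii, `RaysStayInClosure` and `IsFutureOriented`.

Composition `NoHairToFinalState_of : Sig.S1a → Sig.S1b → Sig.S2 → Sig.S3 → NoHairToFinalState` (§3, sorry-free, ~30 lines,
NOT a one-line seam): `isTameChristodoulouGeneric_of_relative'` (sole flat ends of admissible data, S1a, S1b) makes `GoodT2`
tame-generic; `IsTameChristodoulouGeneric.mono` with the pointwise upgrade — per MGHD the census decomposition, per hole the
DOCK (`dock`: the crux hypothesis instantiated at the hole's level bound, at the tree's Levi-Civita instance, `hF`/`hP`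
discharged on the boundaryless carrier by `isOpen_chronological{Future,Past}_holds_of_boundaryless`, `Kerr.Facts` from the
tree), S2 (`choose` over the holes), S3. `lean check --json`: rc 0, sorries 4 = the four `stub_*` (audit: `dock`, `hF_of`,
`hP_of`, `inCensus_of`, `kerrFacts` closed; `noHairToFinalState_of_stubs` = proof-of-item of the route decl, open only through
`sorryAx` of the stubs; `NoHairToFinalState_of` proof.conditional on exactly the four `Sig.stub_*`).

Registered stub signatures are DEF-FREE over this file (expanded over Statement + Lorentz prelude + the landed, farm-built
sibling modules `…OneLockedExplosionDefs`, `…SymplecticDualOfTheBombDefs2`, `…Sig4`; the Sig7 definitions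
`IsOrientationCompatible` / `SettlesDocWithT2` are in the tree but their module is not yet built on the farm, so their BODIES are
inlined), so that stub proofs can land as `Theorems/…` files; §0/§1 give named read-backs (`Censored`, `CensusClauses`,
`InCensus`, `IsDiffeoKerrExterior`, `OrientationCompatible`, `SettlesToCensusHolesT2`, `GoodT2`, `Sig.stub_*`, `*_iff` by
`Iff.rfl`).

Logical position: crux ⟹ S1a (`stub_tameCensorship_of_summit`: censorship is necessary); S1a ∧ S1b ∧ S2 ∧ S3 ⟹ crux (this
file); no stub alone is the crux or the summit (BC3 probes below): S1a says nothing about settling, S1b produces regular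
STATIONARY limits but no Kerr charts (that is where the hypothesis is consumed), S2/S3 are statements about one stationary
hole / one given decomposition and carry no dynamics.

## BC3 probes (seat folder `bc/Probe_<stub>.lean`; they import the route file + landed sibling vocabulary ONLY — not this
## skeleton — so no sorried theorem concluding the crux is in scope for `exact?`)

Combined tactic `first | exact? | simpa | aesop` (400 000 heartbeats), probe A = `stub → NoHairToFinalState`, probe B =
`stub → FinalStateConjecture` — ALL EIGHT FAIL (rc 1):
* `stub_tameCensorship`: rc 1; A — unsolved goals (every alternative failed; aesop: exhaustive search failed); B — unsolved goals (every alternative failed; aesop: exhaustive search failed).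
* `stub_settlingAlongCensoredCurves`: rc 1; A — deterministic timeout at `whnf` (400 000 heartbeats); B — deterministic timeout at `whnf` (400 000 heartbeats).
* `stub_kerrIdentification`: rc 1; A — deterministic timeout at `whnf` (400 000 heartbeats); B — deterministic timeout at `whnf` (400 000 heartbeats).
* `stub_recutTransferT2`: rc 1; A — deterministic timeout at `whnf` (400 000 heartbeats); B — deterministic timeout at `whnf` (400 000 heartbeats).

One tactic per example (`bc/Probe2_<stub>.lean`, same imports and budget), so that every attempt terminates on its own:
* `stub_tameCensorship`: rc 1, 8 failing examples of 8 — A1 exact?: `exact?` could not close the goal; A2 simpa: type mismatch; A3 simpa[NoHairToFinalState,FinalStateConjecture]: type mismatch; A4 aesop: unsolved goals (every alternative failed; aesop: exhaustive search failed); B1 exact?: `exact?` could not close the goal; B2 simpa: type mismatch; B3 simpa[FinalStateConjecture]: type mismatch; B4 aesop: unsolved goals (every alternative failed; aesop: exhaustive search failed).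
* `stub_settlingAlongCensoredCurves`: rc 1, 8 failing examples of 8 — A1 exact?: `exact?` could not close the goal; A2 simpa: type mismatch; A3 simpa[NoHairToFinalState,FinalStateConjecture]: deterministic timeout at `whnf` (400 000 heartbeats); A4 aesop: deterministic timeout at `whnf` (400 000 heartbeats); B1 exact?: `exact?` could not close the goal; B2 simpa: type mismatch; B3 simpa[FinalStateConjecture]: type mismatch; B4 aesop: deterministic timeout at `whnf` (400 000 heartbeats).
* `stub_kerrIdentification`: rc 1, 8 failing examples of 8 — A1 exact?: `exact?` could not close the goal; A2 simpa: type mismatch; A3 simpa[NoHairToFinalState,FinalStateConjecture]: deterministic timeout at `whnf` (400 000 heartbeats); A4 aesop: unsolved goals (every alternative failed; aesop: exhaustive search failed); B1 exact?: `exact?` could not close the goal; B2 simpa: type mismatch; B3 simpa[FinalStateConjecture]: type mismatch; B4 aesop: unsolved goals (every alternative failed; aesop: exhaustive search failed).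
* `stub_recutTransferT2`: rc 1, 8 failing examples of 8 — A1 exact?: `exact?` could not close the goal; A2 simpa: type mismatch; A3 simpa[NoHairToFinalState,FinalStateConjecture]: deterministic timeout at `whnf` (400 000 heartbeats); A4 aesop: deterministic timeout at `whnf` (400 000 heartbeats); B1 exact?: `exact?` could not close the goal; B2 simpa: type mismatch; B3 simpa[FinalStateConjecture]: type mismatch; B4 aesop: deterministic timeout at `whnf` (400 000 heartbeats).
No probe succeeds: no stub is cheaply the crux or the summit (no shredding / costume).

## Disproof used

None exists for this crux (`ledger crux ls stmt-FinalStateConjecture-10828`: no workfiles before this one; no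
`Theorems/NoHairToFinalState/Negative/`). The sibling Disproofs of the identically-shaped frames are honoured:
Cruxes/FinalStateFromKerrOrBomb/Disproof.lean §2 (`without_iff_summit`: a one-hypothesis frame admits no `_false_without_`
theorem short of `¬ FinalStateConjecture`) and §5 (pointwise reduction believed false ⇒ S1b is a CURVE statement);
Cruxes/StationaryLimitReduction/Disproof.lean §5 (∧-non-closure of curve genericity ⇒ composition by `of_relative'`, not by
conjunction). Refuter evidence on this item (Evidence10828.lean, 2026-08-15): `noHairToFinalState_iff` restated here by
`Iff.rfl` against the rev-3/T2 text; `of_summit` (FSC → crux) is the reason probes B are the sharper ones.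
`ledger negatives --problem FinalStateConjecture`: no statement equal or trivially equivalent to any stub (S1a is an OPEN
shared item, stmt-17269, not a negative).

-/

-- every `Summit.FinalStateConjecture.FinalStateConjecture.…` name repeats the summit = sub-problem segment (D-0017 layout)
set_option linter.dupNamespace false
-- instance search through the nested operator types `E4 →L[ℝ] E4 →L[ℝ] ℝ` (as in the sibling Sig modules)
set_option maxSynthPendingDepth 3

noncomputable section

open scoped Manifold ContDiff Topology
open Set Filter Function Literature.Geometry.Lorentzian
open Summit.FinalStateConjecture.FinalStateConjecture.Theorems.OneLockedExplosion (InTelescope ChartIsAsymptoticallyCartesian)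
open Summit.FinalStateConjecture.FinalStateConjecture.Theorems.SymplecticDualOfTheBomb (IsKerrChartedWith HasExhaustiveDocCharts' IsHorizonNormalised docCharted docPart KerrSchildRecutCovering ChartIsAsymptoticallySchwarzschildean')
open Summit.FinalStateConjecture.FinalStateConjecture.Theses.SignedCensus (NoHairToFinalState)

namespace Summit.FinalStateConjecture.FinalStateConjecture.Cruxes.NoHairToFinalState.Birth

/-! ## §0 Vocabulary of the line (documentation and read-backs only: NO registered stub signature mentions a
declaration of this file — they are expanded over the tree, so that stub proofs can land as `Theorems/…` files) -/

/-- The tree's Kerr–Schild chart facts (`Kerr.Facts` is a `Prop` class; inhabited by the tree theorems, exactly as in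
`OneLockedExplosion.IsKerrExterior` / `SwallowTheDatum.kerrFacts`). [folklore] -/
theorem kerrFacts : Kerr.Facts :=
  ⟨Kerr.isConnected_region_holds, Kerr.contMDiff_bilin_holds, Kerr.contMDiff_timeVector_holds⟩

/-- Openness of chronological futures on the (boundaryless) carrier of a stationary hole: the binder `hF` of the
route's graded statement is dischargeable (O'Neill 1983, Ch. 14, Lemma 14.3; tree:
`LorentzianMetric.isOpen_chronologicalFuture_holds_of_boundaryless`). [folklore] -/
theorem hF_of (𝓑 : StationaryAFBlackHole.{0}) : 𝓑.metric.isOpen_chronologicalFuture 𝓑.timeOrientation :=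
  LorentzianMetric.isOpen_chronologicalFuture_holds_of_boundaryless (g := 𝓑.metric) (τ := 𝓑.timeOrientation)

/-- Openness of chronological pasts on the carrier of a stationary hole (binder `hP`). [folklore] -/
theorem hP_of (𝓑 : StationaryAFBlackHole.{0}) : 𝓑.metric.isOpen_chronologicalPast 𝓑.timeOrientation :=
  LorentzianMetric.isOpen_chronologicalPast_holds_of_boundaryless (g := 𝓑.metric) (τ := 𝓑.timeOrientation)

/-- **In the census** — the regularity predicate of route SignedCensus on a stationary asymptotically flat black
hole `𝓑`, i.e. VERBATIM the hypotheses of the route's graded no-hair statement (the antecedent of this crux) under the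
tree's Levi-Civita connection `PseudoRiemannianMetric.hasLeviCivita` (a `Prop` instance, so the choice is immaterial):
globally hyperbolic carrier, the slice a Cauchy hypersurface (corrected notion), connected non-degenerate future event
horizon, stationary Killing field normalised at infinity (`g(T,T) → −1` along the end), BOUNDED horizon rotation level
(`∃ s, g(T,T) ≤ s` on `𝓔⁺` — the graded statement is assumed for every level `s`, so only boundedness is needed;
automatic for a `T`-invariant horizon with compact cross-sections), vacuum. [cite: ChruscielCostaHeusler2012, Conj. 3.4] -/
def InCensus (𝓑 : StationaryAFBlackHole.{0}) : Prop :=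
  haveI : 𝓑.metric.HasLeviCivita := 𝓑.metric.toPseudoRiemannianMetric.hasLeviCivita
  𝓑.metric.IsGloballyHyperbolic 𝓑.timeOrientation ∧
    𝓑.metric.IsCauchyHypersurface 𝓑.timeOrientation (Set.range 𝓑.embed) ∧
      IsConnected 𝓑.horizon ∧ 𝓑.toSpacetime.IsNonDegenerateHorizon 𝓑.Mext ∧
        Filter.Tendsto (fun x ↦ 𝓑.metric.val (𝓑.embed x) (𝓑.killing (𝓑.embed x)) (𝓑.killing (𝓑.embed x)))
            (⨅ R : ℝ, Filter.principal (𝓑.e.far R)) (nhds (-1)) ∧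
          (∃ s : ℝ, ∀ p ∈ 𝓑.horizon, 𝓑.metric.val p (𝓑.killing p) (𝓑.killing p) ≤ s) ∧
            𝓑.metric.toPseudoRiemannianMetric.IsRicciFlat

/-- **The census clauses not already in the sibling telescope** `OneLockedExplosion.InTelescope` (vacuum, connected
horizon, non-degenerate horizon, globally hyperbolic carrier, `T ≠ 0` on the d.o.c.): Cauchy slice, normalisation of
`T` at infinity, bounded rotation level. `InTelescope 𝓑 ∧ CensusClauses 𝓑 → InCensus 𝓑` (`inCensus_of`). These three
clauses are the per-hole property `Q` with which the sibling currency `SettlesDocWithT2 Q` (Sig7, route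
ZeroEnergyKerrOrBomb) is instantiated by this line. [cite: ChruscielCostaHeusler2012, Conj. 3.4] -/
def CensusClauses (𝓑 : StationaryAFBlackHole.{0}) : Prop :=
  𝓑.metric.IsCauchyHypersurface 𝓑.timeOrientation (Set.range 𝓑.embed) ∧
    Filter.Tendsto (fun x ↦ 𝓑.metric.val (𝓑.embed x) (𝓑.killing (𝓑.embed x)) (𝓑.killing (𝓑.embed x)))
        (⨅ R : ℝ, Filter.principal (𝓑.e.far R)) (nhds (-1)) ∧
      ∃ s : ℝ, ∀ p ∈ 𝓑.horizon, 𝓑.metric.val p (𝓑.killing p) (𝓑.killing p) ≤ s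

/-- Telescope + census clauses give the full census predicate (pure logic; both sides use the tree's Levi-Civita
instance, a `Prop`). [folklore] -/
theorem inCensus_of {𝓑 : StationaryAFBlackHole.{0}} (ht : InTelescope 𝓑) (hc : CensusClauses 𝓑) : InCensus 𝓑 := by
  obtain ⟨hvac, hconn, hnd, hgh, -⟩ := ht
  obtain ⟨hcs, hfar, hlev⟩ := hc
  exact ⟨hgh, hcs, hconn, hnd, hfar, hlev, hvac⟩

/-- **The no-hair conclusion in the route's form** for a hole `𝓑` (openness witnesses `hF hP`): a `C^∞` diffeomorphism
`Φ` of the d.o.c. `𝓑.docOpens hF hP` onto a sub-extremal Kerr exterior `Kerr.exterior M a` with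
`g_Kerr(dΦ v, dΦ w) = g(v, w)` — VERBATIM the consequent of the route's graded statement (the unfolded
`IsIsometricToKerrExterior` of `BlackHoles.lean`). [cite: ChruscielCosta2008, Thm. 1.3] -/
def IsDiffeoKerrExterior (𝓑 : StationaryAFBlackHole.{0}) [Kerr.Facts]
    (hF : 𝓑.metric.isOpen_chronologicalFuture 𝓑.timeOrientation)
    (hP : 𝓑.metric.isOpen_chronologicalPast 𝓑.timeOrientation) : Prop :=
  ∃ (M a : ℝ) (_ : Kerr.IsSubextremal M a)
    (Φ : Diffeomorph (𝓡 4) 𝓘(ℝ, E4) (𝓑.docOpens hF hP) (Kerr.exterior M a) ((⊤ : ℕ∞) : WithTop ℕ∞)),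
    ∀ (y : 𝓑.docOpens hF hP) (v w : EuclideanSpace ℝ (Fin 4)),
      (Kerr.smoothMetric M a (Kerr.rPlus M a)).val (Φ y) (mfderiv (𝓡 4) 𝓘(ℝ, E4) Φ y v)
        (mfderiv (𝓡 4) 𝓘(ℝ, E4) Φ y w) = 𝓑.metric.val y.1 v w

section Currency

variable (X : Type) [TopologicalSpace X] [ChartedSpace E3 X] [IsManifold (𝓡 3) ∞ X]
  [T2Space X] [SecondCountableTopology X] [ConnectedSpace X]

/-- **Censored datum (MGHD form)**: an MGHD exists and every MGHD has complete future null infinity — VERBATIM the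
lambda of the shared item `PhaseMixingCapture.WeakCosmicCensorshipTame` (stmt-FinalStateConjecture-17269), the `Q` of
this line's composition along curves. [cite: Christodoulou1999, p. A24] -/
def Censored (D : InitialDataSet (𝓡 3) X) : Prop :=
  (∃ 𝒟 : VacuumCauchyDevelopment D, 𝒟.IsMaximal) ∧ ∀ 𝒟 : VacuumCauchyDevelopment D, 𝒟.IsMaximal → Summit.FinalStateConjecture.HasCompleteNullInfinity 𝒟.toCauchyDevelopment

variable {X} in
/-- **The settling charts respect the time orientations** — VERBATIM the body of the sibling Sig7 definition
`SymplecticDualOfTheBomb.IsOrientationCompatible 𝒟 d` (in tree, p130945; its module is not yet built on the farm, so it is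
restated here rather than imported): orthochronous motions; a hole chart pushes adapted-chart images of `𝓑ᵢ`-future
vectors that land `𝒟`-timelike to `𝒟`-future vectors; the flat chart pushes `∂₀`, where timelike, to the future.
[cite: ONeill1983, Ch. 5  p. 145] -/
def OrientationCompatible {D : InitialDataSet (𝓡 3) X} (𝒟 : VacuumCauchyDevelopment D) {O : Set 𝒟.carrier}
    {k : ℕ} (d : StationaryFinalStateDecomposition 𝒟.toSpacetime O k) : Prop :=
  ((∀ i, Summit.FinalStateConjecture.IsOrthochronous (d.motion i).1) ∧ (∀ (i : Fin d.N) (y : (d.background i).domain) (w : E4), d.toOver.τ₀ < (d.background i).time y.1 → (d.hole i).timeOrientation.IsFutureDirected (mfderiv 𝓘(ℝ, E4) (𝓡 4) (d.adapted i).toFun ⟨poincareInv (d.motion i).1 (d.motion i).2 y.1, ModelBackground.mem_boost_domain.1 y.2⟩ (((d.motion i).1 : E4 ≃L[ℝ] E4).symm w)) → 𝒟.metric.IsTimelike (mfderiv 𝓘(ℝ, E4) (𝓡 4) (d.toOver.chart i) y w) → 𝒟.timeOrientation.IsFutureDirected (mfderiv 𝓘(ℝ, E4) (𝓡 4) (d.toOver.chart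 i) y w)) ∧ ∀ y : d.toOver.flatDomain, d.toOver.τ₀ < (y : E4) 0 → 𝒟.metric.IsTimelike (mfderiv 𝓘(ℝ, E4) (𝓡 4) d.toOver.flatChart y (E4.basisVector 0)) → 𝒟.timeOrientation.IsFutureDirected (mfderiv 𝓘(ℝ, E4) (𝓡 4) d.toOver.flatChart y (E4.basisVector 0)))

/-- **Every MGHD of `D` settles down, in the T2 d.o.c. sense, to CENSUS holes** — the sibling currency
`SettlesDocWithT2 Q X D` (Sig7) with `Q := CensusClauses`, body restated: complete `𝓘⁺`; a `C²` stationary final state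
decomposition `d` (`StationaryFinalStateDecomposition`, prelude) of the honest exterior `O = exteriorOf 𝒟 d.charted`,
exhaustive in the d.o.c. sense with overlap margin (`HasExhaustiveDocCharts'`), horizon-normalised, every
future-complete normalised null ray from the data in the closure of the self-determined d.o.c.
`O ∩ I⁻(docCharted d)`, orientation-compatible charts; every limit hole read in a horizon-covering, asymptotically
Cartesian and `C²`-asymptotically-Schwarzschildean adapted chart, in the telescope (vacuum, connected non-degenerate
horizon, globally hyperbolic, `T ≠ 0` on the d.o.c.), `I⁺`-regular, AND satisfying the census clauses (Cauchy slice,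
normalised `T`, bounded rotation level). This is "asymptotic stationarity" — the limits are REGULAR STATIONARY VACUUM
holes, not a priori Kerr: graded no-hair is what identifies them (the dock), so the crux hypothesis stays
load-bearing. [cite: DafermosLuk2017, §1.2.1 and Conjecture 1] -/
def SettlesToCensusHolesT2 (D : InitialDataSet (𝓡 3) X) : Prop :=
  ∀ 𝒟 : VacuumCauchyDevelopment D, 𝒟.IsMaximal → Summit.FinalStateConjecture.HasCompleteNullInfinity 𝒟.toCauchyDevelopment ∧ ∃ (O : Set 𝒟.carrier) (d : StationaryFinalStateDecomposition 𝒟.toSpacetime O 2), O = Summit.FinalStateConjecture.exteriorOf 𝒟.toCauchyDevelopment d.charted ∧ HasExhaustiveDocCharts' d ∧ IsHorizonNormalised d ∧ Summit.FinalStateConjecture.RaysStayInClosure 𝒟.toCauchyDevelopment (O ∩ 𝒟.metric.chronologicalPast 𝒟.timeOrientation (docCharted d)) ∧ ((∀ i, Summit.FinalStateConjecture.IsOrthochronous (d.motion i).1) ∧ (∀ (i : Fin d.N) (y : (d.background i).domain) (w : E4), d.toOver.τ₀ < (d.background i).time y.1 → (d.hole i).timeOrientation.IsFutureDirected (mfderiv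 𝓘(ℝ, E4) (𝓡 4) (d.adapted i).toFun ⟨poincareInv (d.motion i).1 (d.motion i).2 y.1, ModelBackground.mem_boost_domain.1 y.2⟩ (((d.motion i).1 : E4 ≃L[ℝ] E4).symm w)) → 𝒟.metric.IsTimelike (mfderiv 𝓘(ℝ, E4) (𝓡 4) (d.toOver.chart i) y w) → 𝒟.timeOrientation.IsFutureDirected (mfderiv 𝓘(ℝ, E4) (𝓡 4) (d.toOver.chart i) y w)) ∧ ∀ y : d.toOver.flatDomain, d.toOver.τ₀ < (y : E4) 0 → 𝒟.metric.IsTimelike (mfderiv 𝓘(ℝ, E4) (𝓡 4) d.toOver.flatChart y (E4.basisVector 0)) → 𝒟.timeOrientation.IsFutureDirected (mfderiv 𝓘(ℝ, E4) (𝓡 4) d.toOver.flatChart y (E4.basisVector 0))) ∧ ∀ i, (d.hole i).horizon ⊆ Set.range (d.adapted i).toFun ∧ ChartIsAsymptoticallyCartesian (d.adapted i) ∧ ChartIsAsymptoticallySchwarzschildean' (d.adapted i) ∧ InTelescope (d.hole i) ∧ (d.hole i).IsIPlusRegular ∧ ((d.hole i).metric.IsCauchyHypersurface (d.hole i).timeOrientation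 (Set.range (d.hole i).embed) ∧ Filter.Tendsto (fun x ↦ (d.hole i).metric.val ((d.hole i).embed x) ((d.hole i).killing ((d.hole i).embed x)) ((d.hole i).killing ((d.hole i).embed x))) (⨅ R : ℝ, Filter.principal ((d.hole i).e.far R)) (nhds (-1)) ∧ ∃ s : ℝ, ∀ p ∈ (d.hole i).horizon, (d.hole i).metric.val p ((d.hole i).killing p) ((d.hole i).killing p) ≤ s)

/-- **Good datum (T2, census form)**: an MGHD exists and every MGHD settles to census holes — the `P` of the composition
along curves; the pointwise upgrade `GoodT2 → SummitPropertyT2` given graded no-hair is stubs 2 + 3 (§3).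
[cite: DafermosLuk2017, Conjecture 1] -/
def GoodT2 (D : InitialDataSet (𝓡 3) X) : Prop :=
  (∃ 𝒟 : VacuumCauchyDevelopment D, 𝒟.IsMaximal) ∧ SettlesToCensusHolesT2 X D

end Currency

/-! ## §1 The four stub statements as named propositions (`Sig.stub_<name>`; each is token-identical to the
registered signature of §2, expanded over the tree — Statement, Lorentz prelude, and the LANDED sibling vocabulary
modules `…OneLockedExplosionDefs` / `…SymplecticDualOfTheBombDefs2` / `…Sig4` of route ZeroEnergyKerrOrBomb) -/

/-- Statement of `stub_tameCensorship` (S1a): TAME WEAK COSMIC CENSORSHIP in MGHD form — VERBATIM the shared route item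
`PhaseMixingCapture.WeakCosmicCensorshipTame` (stmt-FinalStateConjecture-17269; closes this stub by `exact` when that
item is proved). (ref: Christodoulou1999, p. A24; arXiv:0811.0354, §2.6.2; DafermosLuk2017, p. 5) -/
def Sig.stub_tameCensorship : Prop :=
  ∀ (X : Type) [TopologicalSpace X] [ChartedSpace Literature.Geometry.Lorentzian.E3 X] [IsManifold (𝓡 3) ((⊤ : ℕ∞) : WithTop ℕ∞) X] [T2Space X] [SecondCountableTopology X] [ConnectedSpace X], Literature.Geometry.Lorentzian.InitialDataSet.IsTameChristodoulouGeneric (Literature.Geometry.Lorentzian.admissibleVacuumData X) (fun D ↦ (∃ 𝒟 : Literature.Geometry.Lorentzian.VacuumCauchyDevelopment D, 𝒟.IsMaximal) ∧ ∀ 𝒟 : Literature.Geometry.Lorentzian.VacuumCauchyDevelopment D, 𝒟.IsMaximal → Summit.FinalStateConjecture.HasCompleteNullInfinity 𝒟.toCauchyDevelopment) 1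

/-- Statement of `stub_settlingAlongCensoredCurves` (S1b): SETTLING TO CENSUS HOLES ALONG CENSORED TAME CURVES — the
`hrel` hypothesis of the tree's composition lemma `InitialDataSet.isTameChristodoulouGeneric_of_relative'` with
`Q := Censored`, `P := GoodT2` (any end for the handed-back curve). (ref: DafermosLuk2017, §1.2.1 and Conjecture 1;
Christodoulou1999, p. A24; arXiv:2104.08222, §1; KehleUnger2025) -/
def Sig.stub_settlingAlongCensoredCurves : Prop :=
  open Literature.Geometry.Lorentzian Summit.FinalStateConjecture.FinalStateConjecture.Theorems.OneLockedExplosion Summit.FinalStateConjecture.FinalStateConjecture.Theorems.SymplecticDualOfTheBomb in open scoped Manifold ContDiff Topology in ∀ (X : Type) [TopologicalSpace X] [ChartedSpace E3 X] [IsManifold (𝓡 3) ∞ X] [T2Space X] [SecondCountableTopology X] [ConnectedSpace X], ∀ (e : AFEnd X) (F : EuclideanSpace ℝ (Fin 1) → InitialDataSet (𝓡 3) X), InitialDataSet.IsTameDataFamily e 1 F → ((InitialDataSet.IsImmersedAtZero 1 F ∧ Function.Injective F) ∨ ∀ c, F c = F 0) → (∀ c, F c ∈ admissibleVacuumData X)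 → (∀ c ≠ 0, (∃ 𝒟 : VacuumCauchyDevelopment (F c), 𝒟.IsMaximal) ∧ ∀ 𝒟 : VacuumCauchyDevelopment (F c), 𝒟.IsMaximal → Summit.FinalStateConjecture.HasCompleteNullInfinity 𝒟.toCauchyDevelopment) → ∃ (e' : AFEnd X) (F' : EuclideanSpace ℝ (Fin 1) → InitialDataSet (𝓡 3) X), InitialDataSet.IsTameDataFamily e' 1 F' ∧ F' 0 = F 0 ∧ Function.Injective F' ∧ InitialDataSet.IsImmersedAtZero 1 F' ∧ (∀ c, F' c ∈ admissibleVacuumData X) ∧ ∀ c ≠ 0, (∃ 𝒟 : VacuumCauchyDevelopment (F' c), 𝒟.IsMaximal) ∧ ∀ 𝒟 : VacuumCauchyDevelopment (F' c), 𝒟.IsMaximal → Summit.FinalStateConjecture.HasCompleteNullInfinity 𝒟.toCauchyDevelopment ∧ ∃ (O : Set 𝒟.carrier) (d : StationaryFinalStateDecomposition 𝒟.toSpacetime O 2), O = Summit.FinalStateConjecture.exteriorOf 𝒟.toCauchyDevelopment d.charted ∧ HasExhaustiveDocCharts' d ∧ IsHorizonNormalised d ∧ Summit.FinalStateConjecture.RaysStayInClosure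 𝒟.toCauchyDevelopment (O ∩ 𝒟.metric.chronologicalPast 𝒟.timeOrientation (docCharted d)) ∧ ((∀ i, Summit.FinalStateConjecture.IsOrthochronous (d.motion i).1) ∧ (∀ (i : Fin d.N) (y : (d.background i).domain) (w : E4), d.toOver.τ₀ < (d.background i).time y.1 → (d.hole i).timeOrientation.IsFutureDirected (mfderiv 𝓘(ℝ, E4) (𝓡 4) (d.adapted i).toFun ⟨poincareInv (d.motion i).1 (d.motion i).2 y.1, ModelBackground.mem_boost_domain.1 y.2⟩ (((d.motion i).1 : E4 ≃L[ℝ] E4).symm w)) → 𝒟.metric.IsTimelike (mfderiv 𝓘(ℝ, E4) (𝓡 4) (d.toOver.chart i) y w) → 𝒟.timeOrientation.IsFutureDirected (mfderiv 𝓘(ℝ, E4) (𝓡 4) (d.toOver.chart i) y w)) ∧ ∀ y : d.toOver.flatDomain, d.toOver.τ₀ < (y : E4) 0 → 𝒟.metric.IsTimelike (mfderiv 𝓘(ℝ, E4) (𝓡 4) d.toOver.flatChart y (E4.basisVector 0)) → 𝒟.timeOrientation.IsFutureDirected (mfderiv 𝓘(ℝ, E4) (𝓡 4) d.toOver.flatChart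 y (E4.basisVector 0))) ∧ ∀ i, (d.hole i).horizon ⊆ Set.range (d.adapted i).toFun ∧ ChartIsAsymptoticallyCartesian (d.adapted i) ∧ ChartIsAsymptoticallySchwarzschildean' (d.adapted i) ∧ InTelescope (d.hole i) ∧ (d.hole i).IsIPlusRegular ∧ ((d.hole i).metric.IsCauchyHypersurface (d.hole i).timeOrientation (Set.range (d.hole i).embed) ∧ Filter.Tendsto (fun x ↦ (d.hole i).metric.val ((d.hole i).embed x) ((d.hole i).killing ((d.hole i).embed x)) ((d.hole i).killing ((d.hole i).embed x))) (⨅ R : ℝ, Filter.principal ((d.hole i).e.far R)) (nhds (-1)) ∧ ∃ s : ℝ, ∀ p ∈ (d.hole i).horizon, (d.hole i).metric.val p ((d.hole i).killing p) ((d.hole i).killing p) ≤ s)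

/-- Statement of `stub_kerrIdentification` (S2): KERR IDENTIFICATION OF A CHARTED CENSUS HOLE, future-preserving — from
the no-hair conclusion in the route's Diffeomorph form to the sibling line's `IsKerrChartedWith` plus the F5 clause.
(ref: ChruscielCosta2008, Thm. 1.3 and §4.3; Bartnik1986, §3; ONeill1995 (Kerr Killing fields)) -/
def Sig.stub_kerrIdentification : Prop :=
  open Literature.Geometry.Lorentzian Summit.FinalStateConjecture.FinalStateConjecture.Theorems.OneLockedExplosion Summit.FinalStateConjecture.FinalStateConjecture.Theorems.SymplecticDualOfTheBomb in open scoped Manifold ContDiff Topology in ∀ (𝓑 : StationaryAFBlackHole.{0}) (A : 𝓑.AdaptedChart) [Kerr.Facts] (hF : 𝓑.metric.isOpen_chronologicalFuture 𝓑.timeOrientation) (hP : 𝓑.metric.isOpen_chronologicalPast 𝓑.timeOrientation), InTelescope 𝓑 → 𝓑.IsIPlusRegular → 𝓑.horizon ⊆ Set.range A.toFun → ChartIsAsymptoticallyCartesian A → ChartIsAsymptoticallySchwarzschildean' A → (∃ (M a : ℝ) (_ : Kerr.IsSubextremal M a) (Φ : Diffeomorph (𝓡 4) 𝓘(ℝ,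 E4) (𝓑.docOpens hF hP) (Kerr.exterior M a) ((⊤ : ℕ∞) : WithTop ℕ∞)), ∀ (y : 𝓑.docOpens hF hP) (v w : EuclideanSpace ℝ (Fin 4)), (Kerr.smoothMetric M a (Kerr.rPlus M a)).val (Φ y) (mfderiv (𝓡 4) 𝓘(ℝ, E4) Φ y v) (mfderiv (𝓡 4) 𝓘(ℝ, E4) Φ y w) = 𝓑.metric.val y.1 v w) → ∃ (M a c r₀ : ℝ) (Θ : E4 → E4), IsKerrChartedWith 𝓑 A M a c r₀ Θ ∧ ∀ u ∈ (Kerr.exterior M a : Set E4), ∀ h : Θ u ∈ A.domain, 𝓑.timeOrientation.IsFutureDirected (mfderiv 𝓘(ℝ, E4) (𝓡 4) A.toFun ⟨Θ u, h⟩ (fderiv ℝ Θ u (Kerr.timeVector M a u)))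

/-- Statement of `stub_recutTransferT2` (S3): ORIENTED KERR–SCHILD RECUT AND T2 CHART TRANSFER — from a settled,
Kerr-identified stationary decomposition to the summit's per-development conclusion. (ref: DafermosLuk2017,
Conjecture 1 (b)–(c); ONeill1983, Ch. 14, Cor. 14.1; arXiv:0811.0354, §5.1) -/
def Sig.stub_recutTransferT2 : Prop :=
  open Literature.Geometry.Lorentzian Summit.FinalStateConjecture.FinalStateConjecture.Theorems.OneLockedExplosion Summit.FinalStateConjecture.FinalStateConjecture.Theorems.SymplecticDualOfTheBomb in open scoped Manifold ContDiff Topology in ∀ (X : Type) [TopologicalSpace X] [ChartedSpace E3 X] [IsManifold (𝓡 3) ∞ X] [T2Space X] [SecondCountableTopology X] [ConnectedSpace X] (D : InitialDataSet (𝓡 3) X) (𝒟 : VacuumCauchyDevelopment D) (O : Set 𝒟.carrier) (d : StationaryFinalStateDecomposition 𝒟.toSpacetime O 2) (M a c r₀ : Fin d.N → ℝ) (Θ : Fin d.N → E4 → E4), O = Summit.FinalStateConjecture.exteriorOf 𝒟.toCauchyDevelopment d.charted → HasExhaustiveDocCharts' d → IsHorizonNormalised d → (∀ i, (d.hole i).horizon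 ⊆ Set.range (d.adapted i).toFun ∧ ChartIsAsymptoticallyCartesian (d.adapted i) ∧ ChartIsAsymptoticallySchwarzschildean' (d.adapted i) ∧ InTelescope (d.hole i) ∧ (d.hole i).IsIPlusRegular) → (∀ i, IsKerrChartedWith (d.hole i) (d.adapted i) (M i) (a i) (c i) (r₀ i) (Θ i)) → (∀ i, ∀ u ∈ (Kerr.exterior (M i) (a i) : Set E4), ∀ h : Θ i u ∈ (d.adapted i).domain, (d.hole i).timeOrientation.IsFutureDirected (mfderiv 𝓘(ℝ, E4) (𝓡 4) (d.adapted i).toFun ⟨Θ i u, h⟩ (fderiv ℝ (Θ i) u (Kerr.timeVector (M i) (a i) u)))) → Summit.FinalStateConjecture.RaysStayInClosure 𝒟.toCauchyDevelopment (O ∩ 𝒟.metric.chronologicalPast 𝒟.timeOrientation (docCharted d)) → ((∀ i, Summit.FinalStateConjecture.IsOrthochronous (d.motion i).1) ∧ (∀ (i : Fin d.N) (y : (d.background i).domain) (w : E4), d.toOver.τ₀ < (d.background i).time y.1 → (d.hole i).timeOrientation.IsFutureDirected (mfderiv 𝓘(ℝ, E4) (𝓡 4) (d.adapted i).toFun ⟨poincareInv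 (d.motion i).1 (d.motion i).2 y.1, ModelBackground.mem_boost_domain.1 y.2⟩ (((d.motion i).1 : E4 ≃L[ℝ] E4).symm w)) → 𝒟.metric.IsTimelike (mfderiv 𝓘(ℝ, E4) (𝓡 4) (d.toOver.chart i) y w) → 𝒟.timeOrientation.IsFutureDirected (mfderiv 𝓘(ℝ, E4) (𝓡 4) (d.toOver.chart i) y w)) ∧ ∀ y : d.toOver.flatDomain, d.toOver.τ₀ < (y : E4) 0 → 𝒟.metric.IsTimelike (mfderiv 𝓘(ℝ, E4) (𝓡 4) d.toOver.flatChart y (E4.basisVector 0)) → 𝒟.timeOrientation.IsFutureDirected (mfderiv 𝓘(ℝ, E4) (𝓡 4) d.toOver.flatChart y (E4.basisVector 0))) → ∃ (O' : Set 𝒟.carrier) (d' : FinalStateDecomposition 𝒟.toSpacetime O' 2), (∀ i, Kerr.IsSubextremal (d'.mass i) (d'.spin i)) ∧ O' = Summit.FinalStateConjecture.exteriorOf 𝒟.toCauchyDevelopment d'.charted ∧ Summit.FinalStateConjecture.RaysStayInClosure 𝒟.toCauchyDevelopment O' ∧ Summit.FinalStateConjecture.HasExhaustiveCharts d' ∧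 Summit.FinalStateConjecture.IsFutureOriented d'

/-! ### Read-backs (definitional): the expanded signatures ARE the named currency -/

/-- S1a is tame genericity of `Censored`. [folklore] -/
theorem sig_tameCensorship_iff : Sig.stub_tameCensorship ↔
    ∀ (X : Type) [TopologicalSpace X] [ChartedSpace E3 X] [IsManifold (𝓡 3) ∞ X] [T2Space X]
      [SecondCountableTopology X] [ConnectedSpace X],
      InitialDataSet.IsTameChristodoulouGeneric (admissibleVacuumData X) (Censored X) 1 :=
  Iff.rfl

/-- S1b is the `hrel` shape with `Q := Censored X`, `P := GoodT2 X`. [folklore] -/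
theorem sig_settlingAlongCensoredCurves_iff : Sig.stub_settlingAlongCensoredCurves ↔
    ∀ (X : Type) [TopologicalSpace X] [ChartedSpace E3 X] [IsManifold (𝓡 3) ∞ X] [T2Space X]
      [SecondCountableTopology X] [ConnectedSpace X],
      ∀ (e : AFEnd X) (F : EuclideanSpace ℝ (Fin 1) → InitialDataSet (𝓡 3) X),
        InitialDataSet.IsTameDataFamily e 1 F →
          ((InitialDataSet.IsImmersedAtZero 1 F ∧ Function.Injective F) ∨ ∀ c, F c = F 0) →
            (∀ c, F c ∈ admissibleVacuumData X) → (∀ c ≠ 0, Censored X (F c)) →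
              ∃ (e' : AFEnd X) (F' : EuclideanSpace ℝ (Fin 1) → InitialDataSet (𝓡 3) X),
                InitialDataSet.IsTameDataFamily e' 1 F' ∧ F' 0 = F 0 ∧ Function.Injective F' ∧
                  InitialDataSet.IsImmersedAtZero 1 F' ∧ (∀ c, F' c ∈ admissibleVacuumData X) ∧
                    ∀ c ≠ 0, GoodT2 X (F' c) :=
  Iff.rfl

/-- The antecedent of S2 is `IsDiffeoKerrExterior` (read-back of the no-hair input format). [folklore] -/
theorem sig_kerrIdentification_iff : Sig.stub_kerrIdentification ↔
    ∀ (𝓑 : StationaryAFBlackHole.{0}) (A : 𝓑.AdaptedChart) [Kerr.Facts]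
      (hF : 𝓑.metric.isOpen_chronologicalFuture 𝓑.timeOrientation)
      (hP : 𝓑.metric.isOpen_chronologicalPast 𝓑.timeOrientation),
      InTelescope 𝓑 → 𝓑.IsIPlusRegular → 𝓑.horizon ⊆ Set.range A.toFun → ChartIsAsymptoticallyCartesian A →
        ChartIsAsymptoticallySchwarzschildean' A → IsDiffeoKerrExterior 𝓑 hF hP →
          ∃ (M a c r₀ : ℝ) (Θ : E4 → E4), IsKerrChartedWith 𝓑 A M a c r₀ Θ ∧
            ∀ u ∈ (Kerr.exterior M a : Set E4), ∀ h : Θ u ∈ A.domain,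
              𝓑.timeOrientation.IsFutureDirected
                (mfderiv 𝓘(ℝ, E4) (𝓡 4) A.toFun ⟨Θ u, h⟩ (fderiv ℝ Θ u (Kerr.timeVector M a u))) :=
  Iff.rfl

/-! ## §2 Registered stubs (`sorry` lives ONLY here; signatures def-free and self-contained) -/

/-- **Stub S1a — TAME WEAK COSMIC CENSORSHIP, MGHD form** (open problem; SHARED: verbatim the route item
`PhaseMixingCapture.WeakCosmicCensorshipTame`, stmt-FinalStateConjecture-17269). For every connected Hausdorff
second-countable `3`-manifold `X`, tame-Christodoulou-generically in `admissibleVacuumData X` (witness curves on ONE fixed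
end, jointly smooth, `wDist`-continuous and immersed at `0`, injective), a maximal vacuum Cauchy development exists and
every MGHD has complete future null infinity (sojourn form). WHY IT MIGHT FAIL: weak cosmic censorship outside symmetry
is open; vacuum naked singularities exist non-generically (Rodnianski–Shlapentokh-Rothman arXiv:1912.08478) and may be
stable under TAME perturbations at fixed asymptotics; in this tree no MGHD of any datum is constructible yet (the
anti-vacuity conjunct). SIZE: open problem. (ref: Christodoulou1999, p. A24; arXiv:0811.0354, §2.6.2; DafermosLuk2017, p. 5) -/
theorem stub_tameCensorship : ∀ (X : Type) [TopologicalSpace X] [ChartedSpace Literature.Geometry.Lorentzian.E3 X] [IsManifold (𝓡 3) ((⊤ : ℕ∞) : WithTop ℕ∞) X] [T2Space X] [SecondCountableTopology X] [ConnectedSpace X], Literature.Geometry.Lorentzian.InitialDataSet.IsTameChristodoulouGeneric (Literature.Geometry.Lorentzian.admissibleVacuumData X) (fun D ↦ (∃ 𝒟 : Literature.Geometry.Lorentzian.VacuumCauchyDevelopment D, 𝒟.IsMaximal) ∧ ∀ 𝒟 : Literature.Geometry.Lorentzian.VacuumCauchyDevelopment D, 𝒟.IsMaximal → Summit.FinalStateConjecture.HasCompleteNullInfinity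 𝒟.toCauchyDevelopment) 1 := by
  sorry

/-- **Stub S1b — SETTLING TO CENSUS HOLES ALONG CENSORED TAME CURVES** (open problem; THE LOAD-BEARING DYNAMICS —
"asymptotic stationarity" of the route's two-layer plan, in the curve form that tame genericity composes). For every
end `e` of `X` and every tame one-parameter family `F` of admissible data on `e` — immersed at `0` and injective, or
constant — whose members off `0` are censored (MGHD exists, every MGHD has complete `𝓘⁺`), there are an end `e'` and a
tame, injective, immersed-at-`0` family `F'` of admissible data with `F' 0 = F 0` whose members off `0` are GOOD in the
census sense: an MGHD exists and every MGHD has complete `𝓘⁺` and a `C²` stationary final state decomposition of its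
honest exterior `O = J⁺(ιX) ∩ I⁻(charted)` — d.o.c.-exhaustive with overlap margin, horizon-normalised, complete rays
in the closure of the self-determined d.o.c., orientation-compatible — onto finitely many receding REGULAR STATIONARY
VACUUM holes read in horizon-covering asymptotically Cartesian / `C²`-Schwarzschildean adapted charts, each in the
telescope (vacuum, connected non-degenerate `𝓔⁺`, globally hyperbolic, `T ≠ 0` on the d.o.c.), `I⁺`-regular, with a
Cauchy slice, `T` normalised at infinity and bounded horizon rotation level (`N = 0` = dispersal). Contents: large-data
asymptotic stationarity of censored developments (Dafermos–Luk's "settle down to finitely many stationary states"), a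
GENERIC third law (non-degenerate limits: leave Kehle–Unger's extremal threshold along a tame curve), presentability of
the limits (`I⁺`-regularity, Cauchy-sliced globally hyperbolic presentation, chart gauges with `C²` rates), the two T2
clauses, and — through GOOD base data — tame-openness of the good set (nonlinear stability of the census limits for
ALL `|a| < M`; print: `|a| ≪ M`, Klainerman–Szeftel / Giorgi–Klainerman–Szeftel; `a = 0` codim-3, DHRT
arXiv:2104.08222). WHY IT MIGHT FAIL: a censored development need not become stationary (eternal radiation / photon-
shell or soliton-like remnants are excluded by no theorem); thresholds of extremal or multi-centre formation may
accumulate along every tame curve through a datum (corner data); honest adapted charts with `C²` Schwarzschildean rate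
may not exist for a rotating limit. Kept as ONE curve statement per the sibling Disproof §5 (curve genericity is not
closed under `∧`; the POINTWISE form "censored ⇒ settles" is believed false: exactly-extremal final states, threshold
data). SIZE: open problem (XL). (ref: DafermosLuk2017, §1.2.1 and Conjecture 1; Christodoulou1999, p. A24;
arXiv:2104.08222, §1; arXiv:2104.11857; arXiv:2205.14808; KehleUnger2025) -/
theorem stub_settlingAlongCensoredCurves : open Literature.Geometry.Lorentzian Summit.FinalStateConjecture.FinalStateConjecture.Theorems.OneLockedExplosion Summit.FinalStateConjecture.FinalStateConjecture.Theorems.SymplecticDualOfTheBomb in open scoped Manifold ContDiff Topology in ∀ (X : Type) [TopologicalSpace X] [ChartedSpace E3 X] [IsManifold (𝓡 3) ∞ X] [T2Space X] [SecondCountableTopology X] [ConnectedSpace X], ∀ (e : AFEnd X) (F : EuclideanSpace ℝ (Fin 1) → InitialDataSet (𝓡 3) X), InitialDataSet.IsTameDataFamily e 1 F → ((InitialDataSet.IsImmersedAtZero 1 F ∧ Function.Injective F) ∨ ∀ c, F c = F 0) → (∀ c, F c ∈ admissibleVacuumData X) → (∀ c ≠ 0, (∃ 𝒟 : VacuumCauchyDevelopment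 (F c), 𝒟.IsMaximal) ∧ ∀ 𝒟 : VacuumCauchyDevelopment (F c), 𝒟.IsMaximal → Summit.FinalStateConjecture.HasCompleteNullInfinity 𝒟.toCauchyDevelopment) → ∃ (e' : AFEnd X) (F' : EuclideanSpace ℝ (Fin 1) → InitialDataSet (𝓡 3) X), InitialDataSet.IsTameDataFamily e' 1 F' ∧ F' 0 = F 0 ∧ Function.Injective F' ∧ InitialDataSet.IsImmersedAtZero 1 F' ∧ (∀ c, F' c ∈ admissibleVacuumData X) ∧ ∀ c ≠ 0, (∃ 𝒟 : VacuumCauchyDevelopment (F' c), 𝒟.IsMaximal) ∧ ∀ 𝒟 : VacuumCauchyDevelopment (F' c), 𝒟.IsMaximal → Summit.FinalStateConjecture.HasCompleteNullInfinity 𝒟.toCauchyDevelopment ∧ ∃ (O : Set 𝒟.carrier) (d : StationaryFinalStateDecomposition 𝒟.toSpacetime O 2), O = Summit.FinalStateConjecture.exteriorOf 𝒟.toCauchyDevelopment d.charted ∧ HasExhaustiveDocCharts' d ∧ IsHorizonNormalised d ∧ Summit.FinalStateConjecture.RaysStayInClosure 𝒟.toCauchyDevelopment (O ∩ 𝒟.metric.chronologicalPast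 𝒟.timeOrientation (docCharted d)) ∧ ((∀ i, Summit.FinalStateConjecture.IsOrthochronous (d.motion i).1) ∧ (∀ (i : Fin d.N) (y : (d.background i).domain) (w : E4), d.toOver.τ₀ < (d.background i).time y.1 → (d.hole i).timeOrientation.IsFutureDirected (mfderiv 𝓘(ℝ, E4) (𝓡 4) (d.adapted i).toFun ⟨poincareInv (d.motion i).1 (d.motion i).2 y.1, ModelBackground.mem_boost_domain.1 y.2⟩ (((d.motion i).1 : E4 ≃L[ℝ] E4).symm w)) → 𝒟.metric.IsTimelike (mfderiv 𝓘(ℝ, E4) (𝓡 4) (d.toOver.chart i) y w) → 𝒟.timeOrientation.IsFutureDirected (mfderiv 𝓘(ℝ, E4) (𝓡 4) (d.toOver.chart i) y w)) ∧ ∀ y : d.toOver.flatDomain, d.toOver.τ₀ < (y : E4) 0 → 𝒟.metric.IsTimelike (mfderiv 𝓘(ℝ, E4) (𝓡 4) d.toOver.flatChart y (E4.basisVector 0)) → 𝒟.timeOrientation.IsFutureDirected (mfderiv 𝓘(ℝ, E4) (𝓡 4) d.toOver.flatChart y (E4.basisVector 0))) ∧ ∀ i, (d.hole i).horizon ⊆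 Set.range (d.adapted i).toFun ∧ ChartIsAsymptoticallyCartesian (d.adapted i) ∧ ChartIsAsymptoticallySchwarzschildean' (d.adapted i) ∧ InTelescope (d.hole i) ∧ (d.hole i).IsIPlusRegular ∧ ((d.hole i).metric.IsCauchyHypersurface (d.hole i).timeOrientation (Set.range (d.hole i).embed) ∧ Filter.Tendsto (fun x ↦ (d.hole i).metric.val ((d.hole i).embed x) ((d.hole i).killing ((d.hole i).embed x)) ((d.hole i).killing ((d.hole i).embed x))) (⨅ R : ℝ, Filter.principal ((d.hole i).e.far R)) (nhds (-1)) ∧ ∃ s : ℝ, ∀ p ∈ (d.hole i).horizon, (d.hole i).metric.val p ((d.hole i).killing p) ((d.hole i).killing p) ≤ s) := by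
  sorry

/-- **Stub S2 — KERR IDENTIFICATION OF A CHARTED CENSUS HOLE, future-preserving** (classical content, L/XL). For a
telescope hole `𝓑` (vacuum, connected non-degenerate horizon, globally hyperbolic, `T ≠ 0` on the d.o.c.), `I⁺`-regular,
read in a horizon-covering, asymptotically Cartesian, `C²`-asymptotically-Schwarzschildean adapted chart `A`, the
no-hair conclusion IN THE ROUTE'S FORM — a `C^∞` diffeomorphism `Φ : ⟨⟨M_ext⟩⟩ ≅ Kerr.exterior M a`, `|a| < M`, with
`g_Kerr(dΦ v, dΦ w) = g(v, w)` (what the crux hypothesis delivers at the dock) — yields a `T`-EQUIVARIANT,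
horizon-regular, asymptotically controlled Kerr identification `Θ` of the chart (`IsKerrChartedWith 𝓑 A M a c r₀ Θ`:
`c > 0`, `Θ` smooth injective on `Kerr.region a r₀ ⊇` a collar behind `r₊`, `Θ(x + s e₀) = Θ x + c s e₀`,
`A.bilin ∘ dΘ = Kerr.bilin M a` on the exterior, `Θ '' exterior = A⁻¹ doc`, bounded tilt / radial distortion / `C¹–C³`
norms far out) which is FUTURE-PRESERVING (`dA(dΘ V_{M,a})` future-directed; `V = −g♯(dt*)`). HOW IT CLOSES: (i) format
bridge `Φ ↦ Ψ := val ∘ Φ⁻¹` to the sibling's `IsKerrExterior 𝓑` (injective isometric immersion with range `doc`;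
M-sized Lean); (ii) the sibling stub `Sig4.stub_kerrIsometryRigidity` (route ZeroEnergyKerrOrBomb, crux 10021/17839; its
wave-3 reduction to F3 `KerrHorizonExtension` ∧ F4 `KerrAsymptoticRigidity` is landed, `…StubKerrIsometryRigidity`,
Kerr facts discharged), i.e. the Killing algebra of Kerr (`Φ_* T = λ ∂_{t*}`, Literature fact `ONeill1995_kerrKillingFields`),
the Boyer–Lindquist reflection, `C^∞` boundary regularity of the d.o.c. isometry at `𝓗⁺` under `I⁺`-regularity
(Chruściel–Costa §4.3) and mass-matched asymptotic rigidity at `i⁰` (Bartnik); (iii) the future clause is the LANDED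
`kerrIdentificationFuture` (p135232, for `InTelescope` holes). WHY IT MIGHT FAIL: only by transcription — F3 (smooth
extension of the equivariant isometry across a non-degenerate horizon from `I⁺`-regularity) is unprinted in this exact
form; the `C²`-rate / tilt bookkeeping of `IsKerrChartedWith` must come out of `ChartIsAsymptoticallySchwarzschildean'`.
SIZE: L/XL. (ref: ChruscielCosta2008, Thm. 1.3 and §4.3 Thm. 4.11; Bartnik1986, §3 Cor. 3.2; ONeill1983, Ch. 5 Lemma 5.26) -/
theorem stub_kerrIdentification : open Literature.Geometry.Lorentzian Summit.FinalStateConjecture.FinalStateConjecture.Theorems.OneLockedExplosion Summit.FinalStateConjecture.FinalStateConjecture.Theorems.SymplecticDualOfTheBomb in open scoped Manifold ContDiff Topology in ∀ (𝓑 : StationaryAFBlackHole.{0}) (A : 𝓑.AdaptedChart) [Kerr.Facts] (hF : 𝓑.metric.isOpen_chronologicalFuture 𝓑.timeOrientation) (hP : 𝓑.metric.isOpen_chronologicalPast 𝓑.timeOrientation), InTelescope 𝓑 → 𝓑.IsIPlusRegular → 𝓑.horizon ⊆ Set.range A.toFun → ChartIsAsymptoticallyCartesian A → ChartIsAsymptoticallySchwarzschildean'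 A → (∃ (M a : ℝ) (_ : Kerr.IsSubextremal M a) (Φ : Diffeomorph (𝓡 4) 𝓘(ℝ, E4) (𝓑.docOpens hF hP) (Kerr.exterior M a) ((⊤ : ℕ∞) : WithTop ℕ∞)), ∀ (y : 𝓑.docOpens hF hP) (v w : EuclideanSpace ℝ (Fin 4)), (Kerr.smoothMetric M a (Kerr.rPlus M a)).val (Φ y) (mfderiv (𝓡 4) 𝓘(ℝ, E4) Φ y v) (mfderiv (𝓡 4) 𝓘(ℝ, E4) Φ y w) = 𝓑.metric.val y.1 v w) → ∃ (M a c r₀ : ℝ) (Θ : E4 → E4), IsKerrChartedWith 𝓑 A M a c r₀ Θ ∧ ∀ u ∈ (Kerr.exterior M a : Set E4), ∀ h : Θ u ∈ A.domain, 𝓑.timeOrientation.IsFutureDirected (mfderiv 𝓘(ℝ, E4) (𝓡 4) A.toFun ⟨Θ u, h⟩ (fderiv ℝ Θ u (Kerr.timeVector M a u))) := by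
  sorry

/-- **Stub S3 — ORIENTED KERR–SCHILD RECUT AND T2 CHART TRANSFER** (L/XL; half landed). For a vacuum Cauchy
development `𝒟`, a `C²` stationary final state decomposition `d` of the honest exterior `O = exteriorOf 𝒟 d.charted`,
d.o.c.-exhaustive with overlap margin, horizon-normalised, with charted telescope holes (`I⁺`-regular, Cartesian /
Schwarzschildean charts), future-preserving Kerr identifications `Θᵢ` of all holes (`IsKerrChartedWith` + F5 clause),
complete rays in the closure of the self-determined d.o.c. and orientation-compatible charts, THERE IS a sub-extremal
Kerr–Schild `FinalStateDecomposition d'` of `O' = exteriorOf 𝒟 d'.charted` with `RaysStayInClosure 𝒟 O'`, exhaustive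
charts at honest radii and future-oriented chart time — verbatim the settled-down conjunct of the re-typed summit for
`𝒟`. HOW IT CLOSES: the naive recut `ψᵢ ∘ (Λᵢ Θᵢ Λᵢ⁻¹)` with the flat chart kept: (a) its causal covering clauses
`KerrSchildRecutCovering 𝒟 d M a Θ` = the sibling stub `Sig4.stub_recutCovering` in ORIENTED form (junction of the flat
and Kerr–Schild slab families on the overlap annuli + near-horizon comparison via horizon normalisation; open part =
`SigM.stub_recutJunctionCoreOriented` of Cruxes/FinalStateFromKerrOrBomb/Lines/SketchIdeator1.lean, reductions landed:
`…RecutCoveringWave3`, `…RecutCoveringGrowingTransfer`, `…RecutCoveringJunctionCore`, helpers p136881); (b) then the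
LANDED T2 transfer `chartTransferT2_unfolded` (p136225: `stub_chartTransferGeneral` p121011/p130371 + ray clause by
past push-up + `IsFutureOriented` from orthochronous motions, orientation compatibility, F5 and eventual timelikeness
from the `C²` convergence). WHY IT MIGHT FAIL: the junction property is unprinted (the summit's covering clauses are
asserted, never derived); without the orientation hypotheses the recut slabs could sit in the causal FUTURE of the
points to be covered (sibling wave-1 finding) — hence they are hypotheses here. SIZE: L/XL.
(ref: DafermosLuk2017, Conjecture 1 (b)–(c); ONeill1983, Ch. 14, Cor. 14.1; arXiv:0811.0354, §5.1) -/
theorem stub_recutTransferT2 : open Literature.Geometry.Lorentzian Summit.FinalStateConjecture.FinalStateConjecture.Theorems.OneLockedExplosion Summit.FinalStateConjecture.FinalStateConjecture.Theorems.SymplecticDualOfTheBomb in open scoped Manifold ContDiff Topology in ∀ (X : Type) [TopologicalSpace X] [ChartedSpace E3 X] [IsManifold (𝓡 3) ∞ X] [T2Space X] [SecondCountableTopology X] [ConnectedSpace X] (D : InitialDataSet (𝓡 3) X) (𝒟 : VacuumCauchyDevelopment D) (O : Set 𝒟.carrier) (d : StationaryFinalStateDecomposition 𝒟.toSpacetime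 O 2) (M a c r₀ : Fin d.N → ℝ) (Θ : Fin d.N → E4 → E4), O = Summit.FinalStateConjecture.exteriorOf 𝒟.toCauchyDevelopment d.charted → HasExhaustiveDocCharts' d → IsHorizonNormalised d → (∀ i, (d.hole i).horizon ⊆ Set.range (d.adapted i).toFun ∧ ChartIsAsymptoticallyCartesian (d.adapted i) ∧ ChartIsAsymptoticallySchwarzschildean' (d.adapted i) ∧ InTelescope (d.hole i) ∧ (d.hole i).IsIPlusRegular) → (∀ i, IsKerrChartedWith (d.hole i) (d.adapted i) (M i) (a i) (c i) (r₀ i) (Θ i)) → (∀ i, ∀ u ∈ (Kerr.exterior (M i) (a i) : Set E4), ∀ h : Θ i u ∈ (d.adapted i).domain, (d.hole i).timeOrientation.IsFutureDirected (mfderiv 𝓘(ℝ, E4) (𝓡 4) (d.adapted i).toFun ⟨Θ i u, h⟩ (fderiv ℝ (Θ i) u (Kerr.timeVector (M i) (a i) u)))) → Summit.FinalStateConjecture.RaysStayInClosure 𝒟.toCauchyDevelopment (O ∩ 𝒟.metric.chronologicalPast 𝒟.timeOrientation (docCharted d)) → ((∀ i, Summit.FinalStateConjecture.IsOrthochronous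 (d.motion i).1) ∧ (∀ (i : Fin d.N) (y : (d.background i).domain) (w : E4), d.toOver.τ₀ < (d.background i).time y.1 → (d.hole i).timeOrientation.IsFutureDirected (mfderiv 𝓘(ℝ, E4) (𝓡 4) (d.adapted i).toFun ⟨poincareInv (d.motion i).1 (d.motion i).2 y.1, ModelBackground.mem_boost_domain.1 y.2⟩ (((d.motion i).1 : E4 ≃L[ℝ] E4).symm w)) → 𝒟.metric.IsTimelike (mfderiv 𝓘(ℝ, E4) (𝓡 4) (d.toOver.chart i) y w) → 𝒟.timeOrientation.IsFutureDirected (mfderiv 𝓘(ℝ, E4) (𝓡 4) (d.toOver.chart i) y w)) ∧ ∀ y : d.toOver.flatDomain, d.toOver.τ₀ < (y : E4) 0 → 𝒟.metric.IsTimelike (mfderiv 𝓘(ℝ, E4) (𝓡 4) d.toOver.flatChart y (E4.basisVector 0)) → 𝒟.timeOrientation.IsFutureDirected (mfderiv 𝓘(ℝ, E4) (𝓡 4) d.toOver.flatChart y (E4.basisVector 0))) → ∃ (O' : Set 𝒟.carrier) (d' : FinalStateDecomposition 𝒟.toSpacetime O' 2), (∀ i, Kerr.IsSubextremal (d'.mass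 i) (d'.spin i)) ∧ O' = Summit.FinalStateConjecture.exteriorOf 𝒟.toCauchyDevelopment d'.charted ∧ Summit.FinalStateConjecture.RaysStayInClosure 𝒟.toCauchyDevelopment O' ∧ Summit.FinalStateConjecture.HasExhaustiveCharts d' ∧ Summit.FinalStateConjecture.IsFutureOriented d' := by
  sorry

/-! ## §3 The dock and the composition: the crux BY NAME from the four stubs (real proof, no `sorry`) -/

/-- **DOCK** (pure logic): the crux hypothesis — rotation-graded smooth no-hair for EVERY level `s`, verbatim — identifies
every census hole with a sub-extremal Kerr exterior in the route's Diffeomorph form: instantiate the graded statement at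
the hole's level bound `s`, at the tree's Levi-Civita instance and any `Kerr.Facts` instance. This is where the
hypothesis of `NoHairToFinalState` is CONSUMED (once per limit hole of every MGHD of every good member). [folklore] -/
theorem dock (hNH : ∀ s : ℝ, ∀ (𝓑 : Literature.Geometry.Lorentzian.StationaryAFBlackHole.{0}) [𝓑.metric.HasLeviCivita] [Literature.Geometry.Lorentzian.Kerr.Facts] (hF : 𝓑.metric.isOpen_chronologicalFuture 𝓑.timeOrientation) (hP : 𝓑.metric.isOpen_chronologicalPast 𝓑.timeOrientation), 𝓑.metric.IsGloballyHyperbolic 𝓑.timeOrientation → 𝓑.metric.IsCauchyHypersurface 𝓑.timeOrientation (Set.range 𝓑.embed) → IsConnected 𝓑.horizon → 𝓑.toSpacetime.IsNonDegenerateHorizon 𝓑.Mext → Filter.Tendsto (fun x ↦ 𝓑.metric.val (𝓑.embed x) (𝓑.killing (𝓑.embed x)) (𝓑.killing (𝓑.embed x))) (⨅ R : ℝ, Filter.principal (𝓑.e.far R)) (nhds (-1)) → (∀ p ∈ 𝓑.horizon, 𝓑.metric.val p (𝓑.killing p) (𝓑.killing p) ≤ s) → 𝓑.metric.toPseudoRiemannianMetric.IsRicciFlat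 → ∃ (M a : ℝ) (_ : Literature.Geometry.Lorentzian.Kerr.IsSubextremal M a) (Φ : Diffeomorph (𝓡 4) 𝓘(ℝ, Literature.Geometry.Lorentzian.E4) (𝓑.docOpens hF hP) (Literature.Geometry.Lorentzian.Kerr.exterior M a) ((⊤ : ℕ∞) : WithTop ℕ∞)), ∀ (y : 𝓑.docOpens hF hP) (v w : EuclideanSpace ℝ (Fin 4)), (Literature.Geometry.Lorentzian.Kerr.smoothMetric M a (Literature.Geometry.Lorentzian.Kerr.rPlus M a)).val (Φ y) (mfderiv (𝓡 4) 𝓘(ℝ, Literature.Geometry.Lorentzian.E4) Φ y v) (mfderiv (𝓡 4) 𝓘(ℝ, Literature.Geometry.Lorentzian.E4) Φ y w) = 𝓑.metric.val y.1 v w)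
    (𝓑 : StationaryAFBlackHole.{0}) [Kerr.Facts]
    (hF : 𝓑.metric.isOpen_chronologicalFuture 𝓑.timeOrientation)
    (hP : 𝓑.metric.isOpen_chronologicalPast 𝓑.timeOrientation) (h : InCensus 𝓑) :
    IsDiffeoKerrExterior 𝓑 hF hP := by
  haveI : 𝓑.metric.HasLeviCivita := 𝓑.metric.toPseudoRiemannianMetric.hasLeviCivita
  obtain ⟨hgh, hcs, hconn, hnd, hfar, ⟨s, hlev⟩, hvac⟩ := h
  exact hNH s 𝓑 hF hP hgh hcs hconn hnd hfar hlev hvac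

/-- Read-back: the crux IS `(graded no-hair, verbatim the binder of the dock) → FinalStateConjecture`. [folklore] -/
theorem noHairToFinalState_iff : NoHairToFinalState ↔ ((∀ s : ℝ, ∀ (𝓑 : Literature.Geometry.Lorentzian.StationaryAFBlackHole.{0}) [𝓑.metric.HasLeviCivita] [Literature.Geometry.Lorentzian.Kerr.Facts] (hF : 𝓑.metric.isOpen_chronologicalFuture 𝓑.timeOrientation) (hP : 𝓑.metric.isOpen_chronologicalPast 𝓑.timeOrientation), 𝓑.metric.IsGloballyHyperbolic 𝓑.timeOrientation → 𝓑.metric.IsCauchyHypersurface 𝓑.timeOrientation (Set.range 𝓑.embed) → IsConnected 𝓑.horizon → 𝓑.toSpacetime.IsNonDegenerateHorizon 𝓑.Mext → Filter.Tendsto (fun x ↦ 𝓑.metric.val (𝓑.embed x) (𝓑.killing (𝓑.embed x)) (𝓑.killing (𝓑.embed x))) (⨅ R : ℝ, Filter.principal (𝓑.e.far R)) (nhds (-1)) → (∀ p ∈ 𝓑.horizon, 𝓑.metric.val p (𝓑.killing p) (𝓑.killing p) ≤ s) → 𝓑.metric.toPseudoRiemannianMetric.IsRicciFlat → ∃ (M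 a : ℝ) (_ : Literature.Geometry.Lorentzian.Kerr.IsSubextremal M a) (Φ : Diffeomorph (𝓡 4) 𝓘(ℝ, Literature.Geometry.Lorentzian.E4) (𝓑.docOpens hF hP) (Literature.Geometry.Lorentzian.Kerr.exterior M a) ((⊤ : ℕ∞) : WithTop ℕ∞)), ∀ (y : 𝓑.docOpens hF hP) (v w : EuclideanSpace ℝ (Fin 4)), (Literature.Geometry.Lorentzian.Kerr.smoothMetric M a (Literature.Geometry.Lorentzian.Kerr.rPlus M a)).val (Φ y) (mfderiv (𝓡 4) 𝓘(ℝ, Literature.Geometry.Lorentzian.E4) Φ y v) (mfderiv (𝓡 4) 𝓘(ℝ, Literature.Geometry.Lorentzian.E4) Φ y w) = 𝓑.metric.val y.1 v w) → _root_.FinalStateConjecture) :=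
  Iff.rfl

/-- **`NoHairToFinalState` from the four stubs** (kernel-checked composition, ~30 lines of logic over the tree):
tame genericity of `GoodT2` by composition along curves (`isTameChristodoulouGeneric_of_relative'`: sole flat ends of
admissible data, S1a as the generic hypothesis, S1b as `hrel`); then `IsTameChristodoulouGeneric.mono` with the
POINTWISE upgrade `GoodT2 D → SummitPropertyT2 D` under graded no-hair: for every MGHD take the census decomposition of
S1b; at every hole the dock (crux hypothesis, `hF`/`hP` discharged on the boundaryless carrier, `Kerr.Facts` from the
tree) gives the Kerr exterior in Diffeomorph form, S2 the future-preserving Kerr identification (`choose` over the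
holes), S3 the summit's conjunct with all T2 clauses. -/
theorem NoHairToFinalState_of :
    Sig.stub_tameCensorship → Sig.stub_settlingAlongCensoredCurves → Sig.stub_kerrIdentification →
      Sig.stub_recutTransferT2 → NoHairToFinalState := by
  intro h1a h1b h2 h3 hNH X _ _ _ _ _ _
  -- Step 1: `GoodT2` is tame-generic, by composition of S1a (generic hypothesis) and S1b (along curves)
  have hgen : InitialDataSet.IsTameChristodoulouGeneric (admissibleVacuumData X) (GoodT2 X) 1 :=
    InitialDataSet.isTameChristodoulouGeneric_of_relative' (Q := Censored X) (P := GoodT2 X)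
      (fun d hd ↦ exists_isSoleEnd_of_mem_admissibleVacuumData hd) (h1a X) (h1b X)
  -- Step 2: pointwise upgrade under graded no-hair
  refine hgen.mono ?_
  rintro D hD ⟨hexists, hsettles⟩
  refine ⟨hexists, fun 𝒟 hmax ↦ ?_⟩
  obtain ⟨hcni, O, d, hO, hexh, hnorm, hrays, horient, hholes⟩ := hsettles 𝒟 hmax
  refine ⟨hcni, ?_⟩
  haveI : Kerr.Facts := kerrFacts
  -- the dock and the identification, hole by hole
  have hid : ∀ i : Fin d.N, ∃ (M a c r₀ : ℝ) (Θ : E4 → E4),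
      IsKerrChartedWith (d.hole i) (d.adapted i) M a c r₀ Θ ∧
        ∀ u ∈ (Kerr.exterior M a : Set E4), ∀ h : Θ u ∈ (d.adapted i).domain,
          (d.hole i).timeOrientation.IsFutureDirected
            (mfderiv 𝓘(ℝ, E4) (𝓡 4) (d.adapted i).toFun ⟨Θ u, h⟩ (fderiv ℝ Θ u (Kerr.timeVector M a u))) := by
    intro i
    obtain ⟨hhor, hcart, hschw, htel, hreg, hcen⟩ := hholes i
    exact h2 (d.hole i) (d.adapted i) (hF_of _) (hP_of _) htel hreg hhor hcart hschw
      (dock hNH (d.hole i) (hF_of _) (hP_of _) (inCensus_of htel hcen))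
  choose M a c r₀ Θ hK hfut using hid
  -- the recut and the T2 transfer
  exact h3 X D 𝒟 O d M a c r₀ Θ hO hexh hnorm
    (fun i ↦ ⟨(hholes i).1, (hholes i).2.1, (hholes i).2.2.1, (hholes i).2.2.2.1, (hholes i).2.2.2.2.1⟩)
    hK hfut hrays horient

/-- **The crux by name, closed modulo the four registered stubs.** -/
theorem noHairToFinalState_of_stubs : NoHairToFinalState :=
  NoHairToFinalState_of stub_tameCensorship stub_settlingAlongCensoredCurves stub_kerrIdentification
    stub_recutTransferT2

/-- Logical position (i): the crux implies S1a — tame censorship is NECESSARY for the summit, hence for the crux given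
its hypothesis (`IsTameChristodoulouGeneric.mono`; cf. `tameCensorship_of_finalStateConjecture` of route
PhaseMixingCapture). Recorded so that refuters see which stub is a consequence. [folklore] -/
theorem stub_tameCensorship_of_summit (h : _root_.FinalStateConjecture) : Sig.stub_tameCensorship := by
  intro X _ _ _ _ _ _
  refine (h X).mono ?_
  rintro D - ⟨hex, hall⟩
  exact ⟨hex, fun 𝒟 hmax ↦ (hall 𝒟 hmax).1⟩

end Summit.FinalStateConjecture.FinalStateConjecture.Cruxes.NoHairToFinalState.Birth

end
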